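import Mathlib
import Summits.ValiantsHypothesis.ValiantsHypothesis.Theorems.NewtonUnitEquationsNewtonTauWeakCornerWords
import Summits.ValiantsHypothesis.ValiantsHypothesis.Theorems.NewtonUnitEquationsNewtonTauWeakK3PaperDefs

/-!
# `NewtonTauWeak` (stmt-ValiantsHypothesis-5904), sub-stub `fixedKCoincidence_t2_K3`: the Laurent ring
# `ℂ[ℤ²]` — embedding, weights, strict initial exponents, products

Support file (paper transcription of `Cruxes/NewtonTauWeak/Lines/binomial-normal-form-ltc.md` §2–§5, the
`K = 3` coincidence rung of KPTT arXiv:1308.2286 Conj. 1 at `t = 2` under "no short 2-vs-1 relations") for the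
crux `Summit.ValiantsHypothesis.ValiantsHypothesis.Theses.NewtonUnitEquations.NewtonTauWeak`.  Routine API of
the objects of `…K3PaperDefs.lean`: the embedding `ιL : ℂ[X,Y] → ℂ[ℤ²]` (coefficients, support, monomials),
real weights on `ℤ²` (a generic weight is injective on `ℤ²`), strict `w`-initial exponents `IsInit`
(uniqueness, existence, characterisation, the bridge `IsTop w f e ↔ IsInit (-w) (ιL f) (zOf e)`), and their
behaviour under products (`IsInit.mul`: initial exponents ADD for a generic weight — `ℂ` is a domain),
unit-like factors, congruences below a weight bound, scalars, translates and sums.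
Main results: `isTop_iff_isInit` (anchor `k3p_isTop_iff_isInit`), `IsInit.mul`, `IsInit.congr_below`.
No definitions. [folklore]
-/

-- the namespace mandated for this Theorems file repeats the component `ValiantsHypothesis`
set_option linter.dupNamespace false

noncomputable section

open scoped BigOperators Polynomial
open AddMonoidAlgebra (single)
open Summit.ValiantsHypothesis.ValiantsHypothesis.Theorems.NewtonTauWeakCorner (wt push OnRay sepCoeff box wt_add wt_zero
  wt_zsmul wt_push push_zero push_single fibreSum IsOrder Active)
open Summit.ValiantsHypothesis.ValiantsHypothesis.Theorems.NewtonTauWeakVdp (wdeg IsGeneric)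

namespace Summit.ValiantsHypothesis.ValiantsHypothesis.Theorems.NewtonTauWeakK3Paper

/-! ## API: `zOf`, `ιL` -/

/-- Routine API (`zOf_apply`). [folklore] -/
@[simp] theorem zOf_apply (e : Fin 2 →₀ ℕ) (i : Fin 2) : zOf e i = ((e i : ℕ) : ℤ) := rfl

/-- Routine API (`zOf_injective`). [folklore] -/
theorem zOf_injective : Function.Injective zOf := by
  intro a b h
  ext i
  have := congrFun h i
  simpa using this

/-- Routine API (`coeff_ιL`). [folklore] -/
theorem coeff_ιL (f : MvPolynomial (Fin 2) ℂ) (e : Fin 2 →₀ ℕ) :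
    (ιL f).coeff (zOf e) = f.coeff e := by
  unfold ιL
  rw [AddMonoidAlgebra.mapDomainRingHom_apply]
  unfold AddMonoidAlgebra.mapDomain
  rw [AddMonoidAlgebra.coeff_ofCoeff]
  exact Finsupp.mapDomain_apply zOf_injective _ _

/-- Routine API (`coeff_ιL_of_not_mem_range`). [folklore] -/
theorem coeff_ιL_of_not_mem_range (f : MvPolynomial (Fin 2) ℂ) (z : Fin 2 → ℤ) (hz : z ∉ Set.range zOf) :
    (ιL f).coeff z = 0 := by
  unfold ιL
  rw [AddMonoidAlgebra.mapDomainRingHom_apply]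
  unfold AddMonoidAlgebra.mapDomain
  rw [AddMonoidAlgebra.coeff_ofCoeff]
  exact Finsupp.mapDomain_notin_range _ _ hz

/-- Routine API (`support_ιL`). [folklore] -/
theorem support_ιL (f : MvPolynomial (Fin 2) ℂ) : (ιL f).coeff.support = f.support.image zOf := by
  unfold ιL
  rw [AddMonoidAlgebra.mapDomainRingHom_apply]
  unfold AddMonoidAlgebra.mapDomain
  rw [AddMonoidAlgebra.coeff_ofCoeff]
  exact Finsupp.mapDomain_support_of_injective zOf_injective _

/-- Routine API (`ιL_monomial`). [folklore] -/
theorem ιL_monomial (e : Fin 2 →₀ ℕ) (a : ℂ) : ιL (MvPolynomial.monomial e a) = single (zOf e) a := by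
  unfold ιL
  rw [AddMonoidAlgebra.mapDomainRingHom_apply, ← MvPolynomial.single_eq_monomial,
    AddMonoidAlgebra.mapDomain_single]

/-- Routine API (`ιL_C`). [folklore] -/
theorem ιL_C (a : ℂ) : ιL (MvPolynomial.C a) = single 0 a := by
  rw [← MvPolynomial.monomial_zero', ιL_monomial, map_zero]

/-! ## API: weights -/

/-- Routine API (`wt_zOf`). [folklore] -/
theorem wt_zOf (w : Fin 2 → ℝ) (e : Fin 2 →₀ ℕ) : wt w (zOf e) = wdeg w e := by
  simp [wt, wdeg]

/-- Routine API (`wt_neg`). [folklore] -/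
theorem wt_neg (w : Fin 2 → ℝ) (z : Fin 2 → ℤ) : wt (-w) z = - wt w z := by
  simp [wt]; ring

/-- Routine API (`wt_sub`). [folklore] -/
theorem wt_sub (w : Fin 2 → ℝ) (z z' : Fin 2 → ℤ) : wt w (z - z') = wt w z - wt w z' := by
  simp only [wt, Pi.sub_apply, Int.cast_sub]; ring

/-- A generic weight (injective on `ℕ²`) is injective on `ℤ²`. -/
theorem wt_injective_of_isGeneric {w : Fin 2 → ℝ} (hw : IsGeneric w) : Function.Injective (wt w) := by
  intro z z' h
  -- write z - z' = a - b with a b ∈ ℕ²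
  have key : ∀ u : Fin 2 → ℤ, wt w u = 0 → u = 0 := by
    intro u hu
    let a : Fin 2 →₀ ℕ := Finsupp.equivFunOnFinite.symm fun i => (u i).toNat
    let b : Fin 2 →₀ ℕ := Finsupp.equivFunOnFinite.symm fun i => (-u i).toNat
    have hab : ∀ i, (u i : ℤ) = (a i : ℤ) - (b i : ℤ) := by
      intro i
      simp only [a, b, Finsupp.coe_equivFunOnFinite_symm]
      exact (Int.toNat_sub_toNat_neg (u i)).symm
    have hwt : wdeg w a = wdeg w b := by
      have : wt w u = wdeg w a - wdeg w b := by
        simp only [wt, wdeg, hab, Int.cast_sub, Int.cast_natCast]; ring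
      linarith
    have := hw hwt
    funext i
    have h2 := hab i
    rw [this] at h2
    simpa using h2
  have h0 : wt w (z - z') = 0 := by rw [wt_sub]; linarith
  have := key _ h0
  exact sub_eq_zero.mp this

/-- Routine API (`wt_neg_injective`). [folklore] -/
theorem wt_neg_injective {w : Fin 2 → ℝ} (hw : Function.Injective (wt w)) : Function.Injective (wt (-w)) := by
  intro z z' h
  rw [wt_neg, wt_neg, neg_inj] at h
  exact hw h

/-! ## API: `IsInit` -/

/-- Routine API (`IsInit.mem`). [folklore] -/
theorem IsInit.mem {w : Fin 2 → ℝ} {F : L} {v : Fin 2 → ℤ} (h : IsInit w F v) : v ∈ F.coeff.support := h.1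

/-- Routine API (`IsInit.coeff_ne_zero`). [folklore] -/
theorem IsInit.coeff_ne_zero {w : Fin 2 → ℝ} {F : L} {v : Fin 2 → ℤ} (h : IsInit w F v) : F.coeff v ≠ 0 :=
  Finsupp.mem_support_iff.mp h.1

/-- Routine API (`IsInit.lt`). [folklore] -/
theorem IsInit.lt {w : Fin 2 → ℝ} {F : L} {v : Fin 2 → ℤ} (h : IsInit w F v) {z : Fin 2 → ℤ}
    (hz : z ∈ F.coeff.support) (hne : z ≠ v) : wt w v < wt w z := h.2 z hz hne

/-- Routine API (`IsInit.le`). [folklore] -/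
theorem IsInit.le {w : Fin 2 → ℝ} {F : L} {v : Fin 2 → ℤ} (h : IsInit w F v) {z : Fin 2 → ℤ}
    (hz : z ∈ F.coeff.support) : wt w v ≤ wt w z := by
  by_cases hne : z = v
  · rw [hne]
  · exact (h.lt hz hne).le

/-- Routine API (`IsInit.unique`). [folklore] -/
theorem IsInit.unique {w : Fin 2 → ℝ} {F : L} {v v' : Fin 2 → ℤ} (h : IsInit w F v) (h' : IsInit w F v') :
    v = v' := by
  by_contra hne
  have h1 := h.lt h'.mem (Ne.symm hne)
  have h2 := h'.lt h.mem hne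
  exact lt_asymm h1 h2

/-- Routine API (`IsInit.ne_zero`). [folklore] -/
theorem IsInit.ne_zero {w : Fin 2 → ℝ} {F : L} {v : Fin 2 → ℤ} (h : IsInit w F v) : F ≠ 0 := by
  rintro rfl
  simp [IsInit] at h

/-- Coefficients below the initial weight vanish. -/
theorem IsInit.coeff_eq_zero_of_lt {w : Fin 2 → ℝ} {F : L} {v : Fin 2 → ℤ} (h : IsInit w F v)
    {z : Fin 2 → ℤ} (hz : wt w z < wt w v) : F.coeff z = 0 := by
  by_contra hne
  have := h.le (Finsupp.mem_support_iff.mpr hne)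
  linarith

/-- Characterisation: nonzero coefficient and all lighter coefficients vanish (generic weight). -/
theorem isInit_iff {w : Fin 2 → ℝ} (hw : Function.Injective (wt w)) (F : L) (v : Fin 2 → ℤ) :
    IsInit w F v ↔ F.coeff v ≠ 0 ∧ ∀ z, wt w z < wt w v → F.coeff z = 0 := by
  constructor
  · intro h
    exact ⟨h.coeff_ne_zero, fun z hz => h.coeff_eq_zero_of_lt hz⟩
  · rintro ⟨hv, hlt⟩
    refine ⟨Finsupp.mem_support_iff.mpr hv, fun z hz hne => ?_⟩
    rcases lt_trichotomy (wt w v) (wt w z) with hl | he | hg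
    · exact hl
    · exact absurd (hw he).symm hne
    · exact absurd (hlt z hg) (Finsupp.mem_support_iff.mp hz)

/-- Existence of the initial exponent of a nonzero element for a generic weight. -/
theorem exists_isInit {w : Fin 2 → ℝ} (hw : Function.Injective (wt w)) {F : L} (hF : F ≠ 0) :
    ∃ v, IsInit w F v := by
  have hne : F.coeff.support.Nonempty := by
    rw [Finset.nonempty_iff_ne_empty, Ne, Finsupp.support_eq_empty]
    intro h
    apply hF
    rw [← AddMonoidAlgebra.ofCoeff_coeff F, h]
    rfl
  obtain ⟨v, hv, hmin⟩ := Finset.exists_min_image F.coeff.support (wt w) hne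
  exact ⟨v, hv, fun z hz hne' => lt_of_le_of_ne (hmin z hz) fun heq => hne' (hw heq).symm⟩

/-- The bridge: strict tops of `f` for `w` are strict initial exponents of `ιL f` for `-w`. -/
theorem isTop_iff_isInit (w : Fin 2 → ℝ) (f : MvPolynomial (Fin 2) ℂ) (e : Fin 2 →₀ ℕ) :
    NewtonTauWeakVdp.IsTop w f e ↔ IsInit (-w) (ιL f) (zOf e) := by
  unfold NewtonTauWeakVdp.IsTop IsInit
  rw [support_ιL]
  constructor
  · rintro ⟨he, hlt⟩
    refine ⟨Finset.mem_image_of_mem _ he, fun z hz hne => ?_⟩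
    obtain ⟨e', he', rfl⟩ := Finset.mem_image.mp hz
    have hne' : e' ≠ e := fun h => hne (by rw [h])
    have := hlt e' he' hne'
    rw [wt_neg, wt_neg, wt_zOf, wt_zOf]
    linarith
  · rintro ⟨he, hlt⟩
    refine ⟨?_, fun e' he' hne => ?_⟩
    · obtain ⟨e'', he'', heq⟩ := Finset.mem_image.mp he
      rwa [← zOf_injective heq]
    · have hne' : zOf e' ≠ zOf e := fun h => hne (zOf_injective h)
      have := hlt (zOf e') (Finset.mem_image_of_mem _ he') hne'
      rw [wt_neg, wt_neg, wt_zOf, wt_zOf] at this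
      linarith


/-! ## API: products in `ℂ[ℤ²]` and initial exponents -/

open scoped Pointwise in
/-- Exponents of a product are sums of exponents. [folklore] -/
theorem exists_add_of_mem_support_mul {F G : L} {z : Fin 2 → ℤ} (hz : z ∈ (F * G).coeff.support) :
    ∃ x ∈ F.coeff.support, ∃ y ∈ G.coeff.support, x + y = z := by
  classical
  have h := AddMonoidAlgebra.support_coeff_mul_subset F G hz
  rw [Finset.mem_add] at h
  obtain ⟨x, hx, y, hy, hxy⟩ := h
  exact ⟨x, hx, y, hy, hxy⟩

/-- The coefficient of a product at the sum of the initial exponents is the product of the initial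
coefficients (generic weight). [folklore] -/
theorem coeff_mul_of_isInit {w : Fin 2 → ℝ} (hw : Function.Injective (wt w)) {F G : L} {a b : Fin 2 → ℤ}
    (hF : IsInit w F a) (hG : IsInit w G b) : (F * G).coeff (a + b) = F.coeff a * G.coeff b := by
  classical
  rw [AddMonoidAlgebra.coeff_mul]
  -- only the pair `(a, b)` contributes
  rw [Finsupp.sum, Finset.sum_eq_single a]
  · rw [Finsupp.sum, Finset.sum_eq_single b]
    · simp
    · intro y hy hyb
      rw [if_neg]
      intro hab
      exact hyb (add_left_cancel hab)
    · intro hb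
      exact absurd hG.mem hb
  · intro x hx hxa
    rw [Finsupp.sum]
    refine Finset.sum_eq_zero fun y hy => ?_
    rw [if_neg]
    intro hxy
    -- weights: wt x ≥ wt a, wt y ≥ wt b, sum equal ⇒ equal
    have h1 := hF.le hx
    have h2 := hG.le hy
    have h3 : wt w x + wt w y = wt w a + wt w b := by rw [← wt_add, ← wt_add, hxy]
    have h4 : wt w x = wt w a := by linarith
    exact hxa (hw h4)
  · intro ha
    exact absurd hF.mem ha

/-- Initial exponents add under products (generic weight; `ℂ` is a domain). [folklore] -/
theorem IsInit.mul {w : Fin 2 → ℝ} (hw : Function.Injective (wt w)) {F G : L} {a b : Fin 2 → ℤ}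
    (hF : IsInit w F a) (hG : IsInit w G b) : IsInit w (F * G) (a + b) := by
  refine ⟨?_, fun z hz hne => ?_⟩
  · rw [Finsupp.mem_support_iff, coeff_mul_of_isInit hw hF hG]
    exact mul_ne_zero hF.coeff_ne_zero hG.coeff_ne_zero
  · obtain ⟨x, hx, y, hy, rfl⟩ := exists_add_of_mem_support_mul hz
    have h1 := hF.le hx
    have h2 := hG.le hy
    rw [wt_add, wt_add]
    rcases lt_or_eq_of_le h1 with h1 | h1
    · linarith
    · rcases lt_or_eq_of_le h2 with h2 | h2
      · linarith
      · exfalso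
        apply hne
        rw [hw h1.symm, hw h2.symm]

/-- An element with nonzero constant term whose other exponents are heavier than `0` has initial
exponent `0`. [folklore] -/
theorem isInit_zero_of_unitLike {w : Fin 2 → ℝ} {G : L} (h0 : G.coeff 0 ≠ 0)
    (hpos : ∀ z ∈ G.coeff.support, z ≠ 0 → 0 < wt w z) : IsInit w G 0 := by
  refine ⟨Finsupp.mem_support_iff.mpr h0, fun z hz hne => ?_⟩
  rw [wt_zero]
  exact hpos z hz hne

/-- Multiplying by a unit-like element does not move the initial exponent. [folklore] -/
theorem IsInit.mul_unitLike {w : Fin 2 → ℝ} (hw : Function.Injective (wt w)) {F G : L} {a : Fin 2 → ℤ}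
    (hF : IsInit w F a) (h0 : G.coeff 0 ≠ 0) (hpos : ∀ z ∈ G.coeff.support, z ≠ 0 → 0 < wt w z) :
    IsInit w (F * G) a := by
  have := hF.mul hw (isInit_zero_of_unitLike h0 hpos)
  rwa [add_zero] at this

/-- Transfer of the initial exponent along a congruence below a weight bound. [folklore] -/
theorem IsInit.congr_below {w : Fin 2 → ℝ} {F F' : L} {a : Fin 2 → ℤ} {c : ℝ} (hF : IsInit w F a)
    (hac : wt w a < c) (hFF' : ∀ z, wt w z < c → F.coeff z = F'.coeff z) : IsInit w F' a := by
  refine ⟨?_, fun z hz hne => ?_⟩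
  · rw [Finsupp.mem_support_iff, ← hFF' a hac]
    exact hF.coeff_ne_zero
  · by_contra hle
    push Not at hle
    have hzc : wt w z < c := lt_of_le_of_lt hle hac
    have hzF : z ∈ F.coeff.support := by
      rw [Finsupp.mem_support_iff, hFF' z hzc]
      exact Finsupp.mem_support_iff.mp hz
    exact absurd (hF.lt hzF hne) (not_lt.mpr hle)

/-- Initial exponent of a scalar multiple. [folklore] -/
theorem IsInit.smul {w : Fin 2 → ℝ} {F : L} {a : Fin 2 → ℤ} (hF : IsInit w F a) {κ : ℂ} (hκ : κ ≠ 0) :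
    IsInit w (κ • F) a := by
  have hsupp : (κ • F).coeff.support = F.coeff.support := by
    rw [AddMonoidAlgebra.coeff_smul]
    exact Finsupp.support_smul_eq hκ
  exact ⟨hsupp ▸ hF.mem, fun z hz hne => hF.lt (hsupp ▸ hz) hne⟩

/-- Initial exponent of a translate. [folklore] -/
theorem IsInit.single_mul {w : Fin 2 → ℝ} {F : L} {a : Fin 2 → ℤ} (hF : IsInit w F a) (p : Fin 2 → ℤ)
    {κ : ℂ} (hκ : κ ≠ 0) : IsInit w (single p κ * F) (p + a) := by
  classical
  have hcoeff : ∀ z, (single p κ * F).coeff (p + z) = κ * F.coeff z := fun z =>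
    AddMonoidAlgebra.coeff_single_mul_add F κ p z
  have hsupp : ∀ z ∈ (single p κ * F).coeff.support, ∃ y ∈ F.coeff.support, p + y = z := by
    intro z hz
    obtain ⟨x, hx, y, hy, rfl⟩ := exists_add_of_mem_support_mul hz
    rw [AddMonoidAlgebra.coeff_single] at hx
    have hx' : x = p := by
      by_contra hne
      rw [Finsupp.mem_support_iff, Finsupp.single_apply, if_neg (Ne.symm hne)] at hx
      exact hx rfl
    exact ⟨y, hy, by rw [hx']⟩
  refine ⟨?_, fun z hz hne => ?_⟩
  · rw [Finsupp.mem_support_iff, hcoeff]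
    exact mul_ne_zero hκ hF.coeff_ne_zero
  · obtain ⟨y, hy, rfl⟩ := hsupp z hz
    have hya : y ≠ a := fun h => hne (by rw [h])
    have := hF.lt hy hya
    rw [wt_add, wt_add]
    linarith

/-- Initial exponent of a sum whose summands have initial exponents of different weights: the
lighter one wins. [folklore] -/
theorem IsInit.add_of_lt {w : Fin 2 → ℝ} {F G : L} {a b : Fin 2 → ℤ} (hF : IsInit w F a) (hG : IsInit w G b)
    (hab : wt w a < wt w b) : IsInit w (F + G) (a) := by
  classical
  refine ⟨?_, fun z hz hne => ?_⟩
  · rw [Finsupp.mem_support_iff, AddMonoidAlgebra.coeff_add, Finsupp.add_apply,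
      hG.coeff_eq_zero_of_lt hab, add_zero]
    exact hF.coeff_ne_zero
  · rw [AddMonoidAlgebra.coeff_add] at hz
    rcases Finset.mem_union.mp (Finsupp.support_add hz) with h | h
    · exact hF.lt h hne
    · exact lt_of_lt_of_le hab (hG.le h)

/-- If the initial exponent of `G` is heavier than some support point of `F + G`... helper: a sum
`F + G` where every exponent of `G` is heavier than `a` and `a` is initial for `F`. [folklore] -/
theorem IsInit.add_of_forall_lt {w : Fin 2 → ℝ} {F G : L} {a : Fin 2 → ℤ} (hF : IsInit w F a)
    (hG : ∀ z ∈ G.coeff.support, wt w a < wt w z) : IsInit w (F + G) a := by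
  classical
  have hGa : G.coeff a = 0 := by
    by_contra h
    exact lt_irrefl _ (hG a (Finsupp.mem_support_iff.mpr h))
  refine ⟨?_, fun z hz hne => ?_⟩
  · rw [Finsupp.mem_support_iff, AddMonoidAlgebra.coeff_add, Finsupp.add_apply, hGa, add_zero]
    exact hF.coeff_ne_zero
  · rw [AddMonoidAlgebra.coeff_add] at hz
    rcases Finset.mem_union.mp (Finsupp.support_add hz) with h | h
    · exact hF.lt h hne
    · exact hG z h

/-- ANCHOR (registered helper stub): the bridge between strict tops of a bivariate polynomial and strict initial
exponents of its image in the Laurent ring. [folklore] -/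
theorem k3p_isTop_iff_isInit (w : Fin 2 → ℝ) (f : MvPolynomial (Fin 2) ℂ) (e : Fin 2 →₀ ℕ) : NewtonTauWeakVdp.IsTop w f e ↔ IsInit (-w) (ιL f) (zOf e) :=
  isTop_iff_isInit w f e

end Summit.ValiantsHypothesis.ValiantsHypothesis.Theorems.NewtonTauWeakK3Paper

end
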